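import Mathlib.Data.Nat.Bits
import Mathlib.Data.Nat.Bitwise
import Literature.Computability.Complexity.MPGSignVerifierRun
import HarnessLib

/-!
# Mean-payoff games over the additive reals: writing a witness for the certificate verifier

Topic `Literature/Computability/Complexity`, grouping namespace `MPGSignVerifier` (continuing
`MPGSignVerifier.lean`). The completeness half of `MPGReal ∈ NDPAdd` needs, for a certificate
`(τ, σ, R, multiplicities)`, a bit string in the layout read by the verifier. This file writes it
and proves that the readers of `MPGSignVerifier.lean` recover the intended data:

* `bitsLE W v` — `v` in `W` bits, least significant first (`bitsToNat_bitsLE`, via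
  `testBit_bitsToNat`); `drop_take_flatMap_blocks` — reading the `j`-th block of a concatenation of
  blocks of equal width;
* `WData` — the data of a witness as total functions on `ℕ` (`tau`, `sig`, `inSet`, `mult`);
  `flagAt k g D p` / `numVal k n D j` — the intended flag at position `p` / value of the `j`-th
  numeric field (the owner / edge CLAIMS are computed from the coordinate function `g` of the
  input: `[g u = 1]`, `[g u < 1]`, `[g (k + uk + u') ≠ 1]`, `[g (k + uk + u') < 1]`);
  `witness k g D` — the bit string (flags, then the numeric fields in `k`-bit blocks);
* reading lemmas at `env k (witness k g D)`: `inR_witness`, `isMax_witness`, `side_witness`,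
  `noEdge_witness`, `noEdgeSide_witness`, `tot_witness`, `succ_witness`, `coef_witness`, and
  `length_witness`.

## References

* H. Fournier, P. Koiran, *Lower bounds are not easier over the reals: inside PH*, ICALP 2000, §3
  (digital nondeterminism: Boolean witnesses). [FournierKoiran2000]
-/

namespace Literature.Computability.Complexity

namespace MPGSignVerifier

open _root_.Computability

/-! ### Fixed-width binary fields -/

/-- `v` written in `W` bits, least significant bit first. [folklore] -/
def bitsLE (W v : ℕ) : List Bool := (List.range W).map v.testBit

/-- A `W`-bit field has `W` bits. [folklore] -/
@[simp] theorem length_bitsLE (W v : ℕ) : (bitsLE W v).length = W := by simp [bitsLE]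

/-- `bitsToNat` reads least significant bit first: bit `t` of the value is entry `t`. [folklore] -/
private theorem testBit_bitsToNat : ∀ (l : List Bool) (t : ℕ), (bitsToNat l).testBit t = l.getD t false
  | [], t => by simp [bitsToNat]
  | b :: l, 0 => by
    rw [show bitsToNat (b :: l) = Nat.bit b (bitsToNat l) by rw [Nat.bit_val, bitsToNat]; ring]
    rw [Nat.testBit_bit_zero]; rfl
  | b :: l, t + 1 => by
    rw [show bitsToNat (b :: l) = Nat.bit b (bitsToNat l) by rw [Nat.bit_val, bitsToNat]; ring]
    rw [Nat.testBit_bit_succ, testBit_bitsToNat l t]; rfl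

/-- Reading back a `W`-bit field. [folklore] -/
theorem bitsToNat_bitsLE {W v : ℕ} (h : v < 2 ^ W) : bitsToNat (bitsLE W v) = v := by
  apply Nat.eq_of_testBit_eq
  intro t
  rw [testBit_bitsToNat, bitsLE, List.getD_eq_getElem?_getD, List.getElem?_map]
  by_cases ht : t < W
  · rw [List.getElem?_range ht]; rfl
  · rw [List.getElem?_eq_none (by simpa using not_lt.1 ht)]
    exact (Nat.testBit_eq_false_of_lt (lt_of_lt_of_le h (Nat.pow_le_pow_right (by norm_num) (not_lt.1 ht)))).symm

/-- Length of a concatenation of `N` blocks of width `W`. [folklore] -/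
theorem length_flatMap_blocks {B : ℕ → List Bool} {W : ℕ} (hB : ∀ j, (B j).length = W) :
    ∀ N, ((List.range N).flatMap B).length = N * W
  | 0 => by simp
  | N + 1 => by
    rw [List.range_succ, List.flatMap_append, List.length_append, length_flatMap_blocks hB N]
    simp [hB, Nat.succ_mul]

/-- Reading the `j`-th block of a concatenation of blocks of width `W`. [folklore] -/
theorem drop_take_flatMap_blocks {B : ℕ → List Bool} {W : ℕ} (hB : ∀ j, (B j).length = W) :
    ∀ (N j : ℕ), j < N → (((List.range N).flatMap B).drop (j * W)).take W = B j
  | 0, j, hj => absurd hj (Nat.not_lt_zero j)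
  | N + 1, j, hj => by
    have hlen := length_flatMap_blocks hB N
    rw [List.range_succ, List.flatMap_append]
    simp only [List.flatMap_cons, List.flatMap_nil, List.append_nil]
    rcases Nat.lt_succ_iff_lt_or_eq.1 hj with hlt | rfl
    · rw [List.drop_append_of_le_length (by rw [hlen]; exact Nat.mul_le_mul_right W hlt.le),
        List.take_append_of_le_length, drop_take_flatMap_blocks hB N j hlt]
      rw [List.length_drop, hlen]
      have : (j + 1) * W ≤ N * W := Nat.mul_le_mul_right W hlt
      rw [Nat.succ_mul] at this
      omega
    · rw [List.drop_left' (by rw [hlen]), List.take_of_length_le (hB _).le]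

/-! ### The data of a witness -/

/-- The data written into a witness, as total functions on `ℕ` (values beyond the arena are junk):
the totality map `tau`, Max's positional choice `sig`, the set `R` (`inSet`) and the multiplicities
`mult v i` of the potentials `π v = Σᵢ mult v i · xᵢ`. [folklore] -/
structure WData where
  /-- `tau u`: an out-neighbour of `u`. -/
  tau : ℕ → ℕ
  /-- `sig u`: Max's choice at `u`. -/
  sig : ℕ → ℕ
  /-- `inSet u`: `u ∈ R`. -/
  inSet : ℕ → Bool
  /-- `mult v i`: multiplicity of the coordinate `i` in `π v`. -/
  mult : ℕ → ℕ → ℕ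

variable (k : ℕ) (g : ℕ → ℝ) (D : WData)

/-- The intended flag at position `p < 3k + 2k²` (membership in `R`; the claims about owner and
edge coordinates, computed from the coordinate function `g` of the input). [folklore] -/
noncomputable def flagAt (p : ℕ) : Bool :=
  if p < k then D.inSet p
  else if p < 2 * k then decide (g (p - k) = 1)
  else if p < 3 * k then decide (g (p - 2 * k) < 1)
  else if p < 3 * k + k * k then decide (g (k + (p - 3 * k)) ≠ 1)
  else decide (g (k + (p - (3 * k + k * k))) < 1)

/-- The intended value of the `j`-th numeric field (`n` the dimension). [folklore] -/
def numVal (n : ℕ) (j : ℕ) : ℕ :=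
  if j < k then D.tau j else if j < 2 * k then D.sig (j - k) else D.mult ((j - 2 * k) / n) ((j - 2 * k) % n)

/-- Number of numeric fields: `2k + kn`. [folklore] -/
def numCount (k : ℕ) : ℕ := 2 * k + k * (k + 2 * k * k)

/-- **The witness**: the `3k + 2k²` flags, then the numeric fields in `k`-bit blocks. [cite: FournierKoiran2000, §3 (Boolean witnesses)] -/
noncomputable def witness : List Bool :=
  (List.range (numBase k)).map (flagAt k g D) ++
    (List.range (numCount k)).flatMap fun j => bitsLE k (numVal k D (k + 2 * k * k) j)

/-- Length of the witness: `3k + 2k² + (2k + kn)k`. [folklore] -/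
theorem length_witness : (witness k g D).length = numBase k + numCount k * k := by
  rw [witness, List.length_append, List.length_map, List.length_range,
    length_flatMap_blocks (fun j => length_bitsLE k _)]

variable {k g D}

/-! ### Reading the witness -/

/-- Flags are read back. [folklore] -/
theorem rd_witness {p : ℕ} (hp : p < numBase k) : rd (env k (witness k g D)) p = flagAt k g D p := by
  rw [rd, env, witness, List.getD_eq_getElem?_getD, List.getElem?_append_left (by simpa using hp),
    List.getElem?_map, List.getElem?_range hp]
  rfl

/-- Numeric fields are read back (when they fit in `k` bits). [folklore] -/
theorem num_witness {j : ℕ} (hj : j < numCount k) (hv : numVal k D (k + 2 * k * k) j < 2 ^ k) :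
    num (env k (witness k g D)) j = numVal k D (k + 2 * k * k) j := by
  rw [num, fld, kOf_env, env, witness]
  dsimp only
  rw [List.drop_append, List.drop_of_length_le (by simp), List.nil_append, List.length_map,
    List.length_range, Nat.add_sub_cancel_left, drop_take_flatMap_blocks (fun j => length_bitsLE k _) _ j hj,
    bitsToNat_bitsLE hv]

/-- `inR` reads `inSet`. [folklore] -/
theorem inR_witness {u : ℕ} (hu : u < k) : inR (env k (witness k g D)) u = D.inSet u := by
  rw [inR, rd_witness (by unfold numBase; nlinarith), flagAt, if_pos hu]

/-- `isMax` reads the claim `[g u = 1]`. [folklore] -/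
theorem isMax_witness {u : ℕ} (hu : u < k) : isMax (env k (witness k g D)) u = decide (g u = 1) := by
  rw [isMax, kOf_env, rd_witness (by unfold numBase; nlinarith), flagAt, if_neg (by omega), if_pos (by omega),
    Nat.add_sub_cancel_left]

/-- `side` reads the claim `[g u < 1]`. [folklore] -/
theorem side_witness {u : ℕ} (hu : u < k) : side (env k (witness k g D)) u = decide (g u < 1) := by
  rw [side, kOf_env, rd_witness (by unfold numBase; nlinarith), flagAt, if_neg (by omega), if_neg (by omega),
    if_pos (by omega), Nat.add_sub_cancel_left]

/-- `noEdge` reads the claim `[g (k + uk + u') ≠ 1]`. [folklore] -/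
theorem noEdge_witness {u u' : ℕ} (hu : u < k) (hu' : u' < k) :
    noEdge (env k (witness k g D)) u u' = decide (g (k + (u * k + u')) ≠ 1) := by
  have hp := pair_lt hu hu'
  rw [noEdge, kOf_env, rd_witness (by unfold numBase; nlinarith), flagAt, if_neg (by omega), if_neg (by omega),
    if_neg (by omega), if_pos (by omega), Nat.add_sub_cancel_left]

/-- `noEdgeSide` reads the claim `[g (k + uk + u') < 1]`. [folklore] -/
theorem noEdgeSide_witness {u u' : ℕ} (hu : u < k) (hu' : u' < k) :
    noEdgeSide (env k (witness k g D)) u u' = decide (g (k + (u * k + u')) < 1) := by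
  have hp := pair_lt hu hu'
  rw [noEdgeSide, kOf_env, rd_witness (by unfold numBase; nlinarith), flagAt, if_neg (by omega), if_neg (by omega),
    if_neg (by omega), if_neg (by omega), Nat.add_sub_cancel_left]

/-- `k < 2^k`-type bound for vertices. [folklore] -/
theorem lt_two_pow_of_lt {v : ℕ} (hv : v < k) : v < 2 ^ k := hv.trans Nat.lt_two_pow_self

/-- `tot` reads `tau` (a vertex). [folklore] -/
theorem tot_witness {u : ℕ} (hu : u < k) (htau : D.tau u < k) : tot (env k (witness k g D)) u = D.tau u := by
  have hval : numVal k D (k + 2 * k * k) u = D.tau u := by rw [numVal, if_pos hu]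
  rw [tot, kOf_env, num_witness (by unfold numCount; have := Nat.zero_le (k * (k + 2 * k * k)); linarith)
    (by rw [hval]; exact lt_two_pow_of_lt htau), hval]
  omega

/-- `succ` reads `sig` (a vertex). [folklore] -/
theorem succ_witness {u : ℕ} (hu : u < k) (hsig : D.sig u < k) : succ (env k (witness k g D)) u = D.sig u := by
  have hval : numVal k D (k + 2 * k * k) (k + u) = D.sig u := by
    rw [numVal, if_neg (by omega), if_pos (by omega), Nat.add_sub_cancel_left]
  rw [succ, kOf_env, num_witness (by unfold numCount; have := Nat.zero_le (k * (k + 2 * k * k)); linarith)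
    (by rw [hval]; exact lt_two_pow_of_lt hsig), hval]
  omega

/-- `coef` reads `mult` (when it fits in `k` bits). [folklore] -/
theorem coef_witness {v i : ℕ} (hv : v < k) (hi : i < k + 2 * k * k) (hmult : D.mult v i < 2 ^ k) :
    coef (env k (witness k g D)) v i = D.mult v i := by
  have hn : 0 < k + 2 * k * k := by omega
  have hval : numVal k D (k + 2 * k * k) (2 * k + (v * (k + 2 * k * k) + i)) = D.mult v i := by
    rw [numVal, if_neg (by omega), if_neg (by omega), Nat.add_sub_cancel_left, Nat.add_comm,
      Nat.add_mul_div_right _ _ hn, Nat.div_eq_of_lt hi, Nat.zero_add, Nat.add_mul_mod_self_right,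
      Nat.mod_eq_of_lt hi]
  have hj : 2 * k + (v * (k + 2 * k * k) + i) < numCount k := by
    have h1 : v * (k + 2 * k * k) + i < k * (k + 2 * k * k) :=
      calc v * (k + 2 * k * k) + i < v * (k + 2 * k * k) + (k + 2 * k * k) := by omega
        _ = (v + 1) * (k + 2 * k * k) := by ring
        _ ≤ k * (k + 2 * k * k) := Nat.mul_le_mul_right _ hv
    unfold numCount; omega
  rw [coef, kOf_env, env_fst, num_witness hj (by rw [hval]; exact hmult), hval]

end MPGSignVerifier

end Literature.Computability.Complexity
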